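import Summits.KontsevichZagierPeriods.KontsevichZagierPeriods.Theses.HurwitzMicroSectors
import Summits.KontsevichZagierPeriods.KontsevichZagierPeriods.Theorems.HurwitzMicroSectorsNormalFormPrinciplePiBoxTransfer
import Summits.KontsevichZagierPeriods.KontsevichZagierPeriods.Theorems.HurwitzMicroSectorsNormalFormPrincipleVariants2308

/-! TTRL-lite variant V2309 of stmt-KontsevichZagierPeriods-3869

Variant V2309 = `stub_boxRigidity` (the leaf `BoxRigidity` of `NormalFormPrinciple`: two representations
on open unit boxes with integrands of KZ's rational shape `p/q` over `ℚ` and equal values are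
KZ-equivalent) under the two-sided move `bound_nat:m≤6; bound_nat:m'≤4` (hypotheses in the order
`m' ≤ 4 → m ≤ 6`). Verdict of the attempt seat: **open** — this file is the exact-strength certificate,
not a proof of the variant. With `BoxVanishing K` := "a box-rational representation of dimension `K` and
value `0` is a relation", the tree's graded lemmas (`boxVanishingDim_left_of_pair`,
`boxRigidityLe_of_boxVanishingDim`, `boxVanishingDim_mono`, file `…Variants2238`) pin the variant exactly:
`V2309 ⟺ BoxVanishing 6 ⟺ BoxRigidity for all m, m' ≤ 6 ⟺ V2308 (m = 6, m' ≤ 4) ⟺ V2302 (m = 6, m' ≤ 2)`: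
(⇒) the pair `(6, 0)` is allowed, so a vanishing box-rational `N` on `(0,1)⁶` is compared with the zero
representation on the point; (⇐) pad both representations (`m ≤ 6`, `m' ≤ 4 ≤ 6`) to `(0,1)⁶` by
Newton–Leibniz moves and subtract the integrands there (value `0` by soundness). So bounding `m ≤ 6`
instead of freezing `m = 6` changes nothing.
`BoxVanishing 6` contains, e.g., "for `a b : ℚ`, `a + b·ζ(5) = 0 ⇒ [a + b/(1 − x₁⋯x₅)]_{(0,1)⁶}` is a
relation" and (by monotonicity) the Catalan dichotomy "`G = q ⇒ [1/(1+x²y²) − q]_{(0,1)²}` is a relation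
for every `q : ℚ`" — provable today only through open irrationality statements or an explicit chain of
moves (none can exist unless the number is rational, by soundness `relations_le_ker_eval_holds`; a
Newton–Leibniz move out of dimension `2` needs a `ℚ`-semialgebraic primitive, and `arctan (xy)/x` is not);
conversely `KontsevichZagierPeriods → V2309` (`stub_boxRigidity_var2309_of_statement`), so a refutation of
the variant would refute the Summit, and the tree has no invariant of `KZ.relations` finer than `KZ.eval`.
Source: M. Kontsevich, D. Zagier, *Periods* (2001), §1.2 Conjecture 1. Pure proof file, no definitions. -/

-- `Summit.<Summit>.<Problem>` is the tree's mandated summit-side namespace (CONVENTIONS §2); for this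
-- single-conjunct summit the two coincide, so the duplicate is deliberate.
set_option linter.dupNamespace false

noncomputable section

namespace Summit.KontsevichZagierPeriods.KontsevichZagierPeriods.Theorems

open MeasureTheory Set
open Literature.NumberTheory.Transcendental Literature.NumberTheory.Transcendental.KZ
open Summit.KontsevichZagierPeriods.KontsevichZagierPeriods.Theses.HurwitzMicroSectors
open Summit.KontsevichZagierPeriods.HurwitzMicroSectors.NormalFormPrinciple.PiBox

/-- **V2309 ⟺ `BoxVanishing 6`**: (⇒) the pair `(6, 0)` is allowed (`0 ≤ 4`, `6 ≤ 6`), so compare a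
vanishing box-rational representation on `(0,1)⁶` with the zero representation on the point
(`boxVanishingDim_left_of_pair`); (⇐) `boxRigidityLe_of_boxVanishingDim 6` with `m ≤ 6`, `m' ≤ 4 ≤ 6`.
[cite: KontsevichZagier2001, §1.2 Conjecture 1] -/
theorem stub_boxRigidity_var2309_iff_boxVanishing_six :
    (∀ (m m' : ℕ) (N : IntegralRep m) (N' : IntegralRep m'), m' ≤ 4 → m ≤ 6 → N.domain = {x | ∀ i, x i ∈ Set.Ioo (0:ℝ) 1} → N.IsRational → N'.domain = {x | ∀ i, x i ∈ Set.Ioo (0:ℝ) 1} → N'.IsRational → N.value = N'.value → Equivalent N N') ↔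
    (∀ (M : IntegralRep 6), M.domain = {x | ∀ i, x i ∈ Set.Ioo (0:ℝ) 1} → M.IsRational →
      M.value = 0 → of M ∈ relations) :=
  ⟨fun h => boxVanishingDim_left_of_pair 6 0 fun N N' => h 6 0 N N' (Nat.zero_le 4) le_rfl,
    fun hvan m m' N N' hm' hm =>
      boxRigidityLe_of_boxVanishingDim 6 hvan m m' N N' hm (hm'.trans (by norm_num))⟩

/-- **V2309 ⟺ the sibling V2308** (`fix_nat:m=6; bound_nat:m'≤4`): both are `BoxVanishing 6`
(`stub_boxRigidity_var2308_iff_boxVanishing_six`), so bounding `m ≤ 6` instead of freezing `m = 6`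
adds nothing. [cite: KontsevichZagier2001, §1.2 Conjecture 1] -/
theorem stub_boxRigidity_var2309_iff_var2308 :
    (∀ (m m' : ℕ) (N : IntegralRep m) (N' : IntegralRep m'), m' ≤ 4 → m ≤ 6 → N.domain = {x | ∀ i, x i ∈ Set.Ioo (0:ℝ) 1} → N.IsRational → N'.domain = {x | ∀ i, x i ∈ Set.Ioo (0:ℝ) 1} → N'.IsRational → N.value = N'.value → Equivalent N N') ↔
    (∀ (m' : ℕ) (N : IntegralRep 6) (N' : IntegralRep m'), m' ≤ 4 → N.domain = {x | ∀ i, x i ∈ Set.Ioo (0:ℝ) 1} → N.IsRational → N'.domain = {x | ∀ i, x i ∈ Set.Ioo (0:ℝ) 1} → N'.IsRational → N.value = N'.value → Equivalent N N') := by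
  rw [stub_boxRigidity_var2309_iff_boxVanishing_six, stub_boxRigidity_var2308_iff_boxVanishing_six]

/-- **V2309 ⟺ the sibling V2302** (`fix_nat:m=6; bound_nat:m'≤2`): both are `BoxVanishing 6`
(`stub_boxRigidity_var2302_iff_boxVanishing_six`). [cite: KontsevichZagier2001, §1.2 Conjecture 1] -/
theorem stub_boxRigidity_var2309_iff_var2302 :
    (∀ (m m' : ℕ) (N : IntegralRep m) (N' : IntegralRep m'), m' ≤ 4 → m ≤ 6 → N.domain = {x | ∀ i, x i ∈ Set.Ioo (0:ℝ) 1} → N.IsRational → N'.domain = {x | ∀ i, x i ∈ Set.Ioo (0:ℝ) 1} → N'.IsRational → N.value = N'.value → Equivalent N N') ↔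
    (∀ (m' : ℕ) (N : IntegralRep 6) (N' : IntegralRep m'), m' ≤ 2 → N.domain = {x | ∀ i, x i ∈ Set.Ioo (0:ℝ) 1} → N.IsRational → N'.domain = {x | ∀ i, x i ∈ Set.Ioo (0:ℝ) 1} → N'.IsRational → N.value = N'.value → Equivalent N N') := by
  rw [stub_boxRigidity_var2309_iff_boxVanishing_six, stub_boxRigidity_var2302_iff_boxVanishing_six]

/-- **V2309 ⟺ `BoxRigidity` for all `m, m' ≤ 6`** (the honest strength of the variant: Conjecture 1 for
all pairs of rational integrands on the open unit boxes of dimension at most `6`; the asymmetric bound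
`m' ≤ 4` is not a weakening). [cite: KontsevichZagier2001, §1.2 Conjecture 1] -/
theorem stub_boxRigidity_var2309_iff_le_six :
    (∀ (m m' : ℕ) (N : IntegralRep m) (N' : IntegralRep m'), m' ≤ 4 → m ≤ 6 → N.domain = {x | ∀ i, x i ∈ Set.Ioo (0:ℝ) 1} → N.IsRational → N'.domain = {x | ∀ i, x i ∈ Set.Ioo (0:ℝ) 1} → N'.IsRational → N.value = N'.value → Equivalent N N') ↔
    (∀ (m m' : ℕ) (N : IntegralRep m) (N' : IntegralRep m'), m ≤ 6 → m' ≤ 6 →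
      N.domain = {x | ∀ i, x i ∈ Set.Ioo (0:ℝ) 1} → N.IsRational →
      N'.domain = {x | ∀ i, x i ∈ Set.Ioo (0:ℝ) 1} → N'.IsRational →
      N.value = N'.value → Equivalent N N') := by
  rw [stub_boxRigidity_var2309_iff_var2302]
  exact stub_boxRigidity_var2302_iff_le_six

/-- **V2309 gives `BoxVanishing j` for every `j ≤ 6`** (`boxVanishingDim_mono`): in particular the
dimension-`2` (Catalan) and dimension-`5` (`ζ(5)`) dichotomies quoted in the file docstring.
[cite: KontsevichZagier2001, §1.2 Conjecture 1] -/
theorem boxVanishing_le_six_of_stub_boxRigidity_var2309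
    (h : ∀ (m m' : ℕ) (N : IntegralRep m) (N' : IntegralRep m'), m' ≤ 4 → m ≤ 6 → N.domain = {x | ∀ i, x i ∈ Set.Ioo (0:ℝ) 1} → N.IsRational → N'.domain = {x | ∀ i, x i ∈ Set.Ioo (0:ℝ) 1} → N'.IsRational → N.value = N'.value → Equivalent N N')
    {j : ℕ} (hj : j ≤ 6) :
    ∀ (M : IntegralRep j), M.domain = {x | ∀ i, x i ∈ Set.Ioo (0:ℝ) 1} → M.IsRational →
      M.value = 0 → of M ∈ relations :=
  boxVanishingDim_mono hj (stub_boxRigidity_var2309_iff_boxVanishing_six.1 h)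

/-- **`BoxVanishing 6` alone already proves V2309** (the residual of the variant, stated as the
missing lemma). [cite: KontsevichZagier2001, §1.2 Conjecture 1] -/
theorem stub_boxRigidity_var2309_of_boxVanishing_six
    (hvan : ∀ (M : IntegralRep 6), M.domain = {x | ∀ i, x i ∈ Set.Ioo (0:ℝ) 1} → M.IsRational →
      M.value = 0 → of M ∈ relations) :
    ∀ (m m' : ℕ) (N : IntegralRep m) (N' : IntegralRep m'), m' ≤ 4 → m ≤ 6 → N.domain = {x | ∀ i, x i ∈ Set.Ioo (0:ℝ) 1} → N.IsRational → N'.domain = {x | ∀ i, x i ∈ Set.Ioo (0:ℝ) 1} → N'.IsRational → N.value = N'.value → Equivalent N N' :=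
  stub_boxRigidity_var2309_iff_boxVanishing_six.2 hvan

/-- **The parent leaf ⇒ V2309** (drop both bounds). [cite: KontsevichZagier2001, §1.2 Conjecture 1] -/
theorem stub_boxRigidity_var2309_of_parent
    (h : ∀ (m m' : ℕ) (N : IntegralRep m) (N' : IntegralRep m'), N.domain = {x | ∀ i, x i ∈ Set.Ioo (0:ℝ) 1} → N.IsRational → N'.domain = {x | ∀ i, x i ∈ Set.Ioo (0:ℝ) 1} → N'.IsRational → N.value = N'.value → Equivalent N N') :
    ∀ (m m' : ℕ) (N : IntegralRep m) (N' : IntegralRep m'), m' ≤ 4 → m ≤ 6 → N.domain = {x | ∀ i, x i ∈ Set.Ioo (0:ℝ) 1} → N.IsRational → N'.domain = {x | ∀ i, x i ∈ Set.Ioo (0:ℝ) 1} → N'.IsRational → N.value = N'.value → Equivalent N N' :=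
  fun m m' N N' _ _ => h m m' N N'

/-- **`KontsevichZagierPeriods ⇒ V2309`**: the variant is a special case of Conjecture 1 for the
tree's calculus (`leaves_of_statement`) — so a refutation of the variant would refute the Summit.
[cite: KontsevichZagier2001, §1.2 Conjecture 1] -/
theorem stub_boxRigidity_var2309_of_statement (h : _root_.KontsevichZagierPeriods) :
    ∀ (m m' : ℕ) (N : IntegralRep m) (N' : IntegralRep m'), m' ≤ 4 → m ≤ 6 → N.domain = {x | ∀ i, x i ∈ Set.Ioo (0:ℝ) 1} → N.IsRational → N'.domain = {x | ∀ i, x i ∈ Set.Ioo (0:ℝ) 1} → N'.IsRational → N.value = N'.value → Equivalent N N' :=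
  stub_boxRigidity_var2309_of_parent (leaves_of_statement h).1

end Summit.KontsevichZagierPeriods.KontsevichZagierPeriods.Theorems

end
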